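import Summits.CriticalPhenomena.PercolationContinuityZ3.Theorems.SahiMasterFamilyMinors

/-!
# Support calculus for the zero-flag class: essential supports, `Z_2`, and Lemma Z (unpacking `Z_3`)

Companion of `SahiMasterFamilyMinors.lean` (unit `prim-master-conj`).  The terminal analysis of (T) (paper:
STRUCTURE-PROOF.md §4–§13, verified VERIFICATION-gen3.md) manipulates the zero-flag class `Z_3 = SuppZeroFlag 3`
through essential supports and pivotal configurations.  This file provides that calculus:

* `esupp A` — the essential support `{i | Affects A i}` of an event as a `Finset` (Kahn's `Z(A)`,
  `Literature…Kahn2022.Affects`); an increasing event is determined by it (`determinedBy_esupp`) and every determining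
  set contains it (`esupp_subset_of_determinedBy`);
* `suppZeroFlag_two_iff` — for increasing events, `(X, Y) ∈ Z_2` iff `esupp X` and `esupp Y` are disjoint;
* `ZVia X Y G` ("`(X, Y, G) ∈ Z_3` via the pair `(X, Y)`") and `suppZeroFlag_three_iff_zVia` — `Z_3` membership of
  `![X, Y, G]` is the disjunction of the three slot choices;
* **Lemma Z** (`zVia_pivotal`): for increasing events, `ZVia X Y G` gives `esupp X ∩ esupp Y = ∅` together with the two
  pivotality exclusions "no configuration of `X` is `t`-pivotal for `G`, `t ∈ esupp Y`" and symmetrically;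
* sections versus supports (`esupp_secAt_subset`, `mem_esupp_secAt_or`, `secAt_eq_self_of_not_affects`).
Everything here is proved; axioms standard. [this work]
-/

noncomputable section

open scoped Classical

namespace Summit.CriticalPhenomena.PercolationContinuityZ3.Theorems

open Finset Function
open Literature.Probability.Percolation (DeterminedBy determinedBy_iff)
open Literature.Probability.LatticeModels.Kahn2022 (Affects determinedBy_affects)

variable {ι : Type*} [Fintype ι]

/-! ### Essential support -/

/-- **Essential support** `esupp A = {i | Affects A i}` (Kahn's `Z(A)`): the coordinates whose insertion can move a
configuration into `A`. [folklore] -/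
def esupp (A : Set (Set ι)) : Finset ι := univ.filter fun i => Affects A i

omit [Fintype ι] in
/-- Unfolding `Affects`. [folklore] -/
theorem affects_iff {A : Set (Set ι)} {i : ι} : Affects A i ↔ ∃ ω : Set ι, ω ∉ A ∧ insert i ω ∈ A := Iff.rfl

/-- Membership in the essential support. [folklore] -/
theorem mem_esupp {A : Set (Set ι)} {i : ι} : i ∈ esupp A ↔ Affects A i := by
  simp [esupp]

/-- The essential support as a set is `{i | Affects A i}`. [folklore] -/
theorem coe_esupp (A : Set (Set ι)) : (↑(esupp A) : Set ι) = {i | Affects A i} := by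
  ext i; simp [esupp]

/-- An increasing event is determined by its essential support. [folklore] -/
theorem determinedBy_esupp {A : Set (Set ι)} (hA : IsUpperSet A) : DeterminedBy A (↑(esupp A) : Set ι) := by
  rw [coe_esupp]; exact determinedBy_affects hA

/-- Every determining set contains the essential support. [folklore] -/
theorem esupp_subset_of_determinedBy {A : Set (Set ι)} {S : Finset ι} (hS : DeterminedBy A (↑S : Set ι)) :
    esupp A ⊆ S := by
  intro i hi
  rw [mem_esupp] at hi
  obtain ⟨ω, hω, hiω⟩ := hi
  by_contra hiS
  have h := (determinedBy_iff A ↑S).1 hS ω (insert i ω) (by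
    ext j
    simp only [Set.mem_inter_iff, Set.mem_insert_iff, mem_coe]
    constructor
    · rintro ⟨hj, hjS⟩; exact ⟨Or.inr hj, hjS⟩
    · rintro ⟨rfl | hj, hjS⟩
      · exact absurd hjS hiS
      · exact ⟨hj, hjS⟩)
  exact hω (h.2 hiω)

omit [Fintype ι] in
/-- For an increasing event, a non-affecting coordinate can be inserted or removed freely. [folklore] -/
theorem insert_mem_iff_of_not_affects {A : Set (Set ι)} (hA : IsUpperSet A) {i : ι} (hi : ¬ Affects A i)
    (ω : Set ι) : insert i ω ∈ A ↔ ω ∈ A :=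
  ⟨fun h => by_contra fun hω => hi ⟨ω, hω, h⟩, fun h => hA (Set.subset_insert i ω) h⟩

omit [Fintype ι] in
/-- A nonempty increasing event contains the full configuration. [folklore] -/
theorem univ_mem_of_nonempty {A : Set (Set ι)} (hA : IsUpperSet A) (hne : A.Nonempty) : Set.univ ∈ A := by
  obtain ⟨ω, hω⟩ := hne
  exact hA (Set.subset_univ ω) hω

/-- An event with nonempty essential support is nonempty and not everything. [folklore] -/
theorem nonempty_of_esupp_nonempty {A : Set (Set ι)} (h : (esupp A).Nonempty) : A.Nonempty ∧ A ≠ Set.univ := by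
  obtain ⟨i, hi⟩ := h
  obtain ⟨ω, hω, hiω⟩ := mem_esupp.1 hi
  exact ⟨⟨_, hiω⟩, fun h => hω (h ▸ Set.mem_univ ω)⟩

/-- Membership in an increasing event depends only on the trace on the essential support. [folklore] -/
theorem mem_iff_of_inter_esupp_eq {A : Set (Set ι)} (hA : IsUpperSet A) {ω ω' : Set ι}
    (h : ω ∩ ↑(esupp A) = ω' ∩ ↑(esupp A)) : ω ∈ A ↔ ω' ∈ A :=
  (determinedBy_iff A _).1 (determinedBy_esupp hA) ω ω' h

/-! ### `Z_2` for increasing events -/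

/-- **`Z_2` = disjoint essential supports** (increasing events). [this work] -/
theorem suppZeroFlag_two_iff {X Y : Set (Set ι)} (hX : IsUpperSet X) (hY : IsUpperSet Y) :
    SuppZeroFlag 2 ![X, Y] ↔ Disjoint (esupp X) (esupp Y) := by
  constructor
  · rintro ⟨S, T, hST, hS, hT⟩
    exact Finset.disjoint_of_subset_left (esupp_subset_of_determinedBy hS)
      (Finset.disjoint_of_subset_right (esupp_subset_of_determinedBy hT) hST)
  · intro h
    exact ⟨esupp X, esupp Y, h, determinedBy_esupp hX, determinedBy_esupp hY⟩

omit [Fintype ι] in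
/-- `Z_2` of a `Fin 2`-family is `Z_2` of its two members. [folklore] -/
theorem suppZeroFlag_two_eta (U : Fin 2 → Set (Set ι)) : SuppZeroFlag 2 U ↔ SuppZeroFlag 2 ![U 0, U 1] := by
  have : U = ![U 0, U 1] := by funext j; fin_cases j <;> rfl
  exact ⟨fun h => this ▸ h, fun h => this.symm ▸ h⟩

/-! ### Lemma Z: unpacking `Z_3` -/

/-- **`(X, Y, G) ∈ Z_3` via the pair `(X, Y)`**: `(X,Y)`, `(X ∩ G, Y)` and `(X, Y ∩ G)` are in `Z_2`. [this work] -/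
def ZVia (X Y G : Set (Set ι)) : Prop :=
  SuppZeroFlag 2 ![X, Y] ∧ SuppZeroFlag 2 ![X ∩ G, Y] ∧ SuppZeroFlag 2 ![X, Y ∩ G]

omit [Fintype ι] in
/-- `Z_3` membership of a `Fin 3`-family, with the peeled pair and its two modifications written as explicit pairs.
[this work] -/
theorem suppZeroFlag_three_iff_exists (U : Fin 3 → Set (Set ι)) :
    SuppZeroFlag 3 U ↔ ∃ i : Fin 3, SuppZeroFlag 2 ![U (i.succAbove 0), U (i.succAbove 1)] ∧
      SuppZeroFlag 2 ![U (i.succAbove 0) ∩ U i, U (i.succAbove 1)] ∧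
      SuppZeroFlag 2 ![U (i.succAbove 0), U (i.succAbove 1) ∩ U i] := by
  have h10 : (1 : Fin 2) ≠ 0 := by decide
  have h01 : (0 : Fin 2) ≠ 1 := by decide
  have conv : ∀ i : Fin 3, (SuppZeroFlag 2 (fun j => U (i.succAbove j)) ∧
      ∀ l : Fin 2, SuppZeroFlag 2 (update (fun j => U (i.succAbove j)) l (U (i.succAbove l) ∩ U i))) ↔
      (SuppZeroFlag 2 ![U (i.succAbove 0), U (i.succAbove 1)] ∧
        SuppZeroFlag 2 ![U (i.succAbove 0) ∩ U i, U (i.succAbove 1)] ∧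
        SuppZeroFlag 2 ![U (i.succAbove 0), U (i.succAbove 1) ∩ U i]) := by
    intro i
    rw [suppZeroFlag_two_eta (fun j => U (i.succAbove j))]
    constructor
    · rintro ⟨h, hl⟩
      refine ⟨h, ?_, ?_⟩
      · have h0 := hl 0
        rw [suppZeroFlag_two_eta] at h0
        simpa only [update_self, update_of_ne h10] using h0
      · have h1 := hl 1
        rw [suppZeroFlag_two_eta] at h1
        simpa only [update_self, update_of_ne h01] using h1
    · rintro ⟨h, h0, h1⟩
      refine ⟨h, fun l => ?_⟩
      rw [suppZeroFlag_two_eta]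
      rcases Fin.exists_fin_two.1 ⟨l, rfl⟩ with hl | hl
      · rw [hl]; simpa only [update_self, update_of_ne h10] using h0
      · rw [hl]; simpa only [update_self, update_of_ne h01] using h1
  exact ⟨fun ⟨i, hi⟩ => ⟨i, (conv i).1 hi⟩, fun ⟨i, hi⟩ => ⟨i, (conv i).2 hi⟩⟩

omit [Fintype ι] in
/-- **`Z_3` is the disjunction of the three slot choices**: `![X, Y, G] ∈ Z_3` iff it is in `Z_3` via `(Y, G)`
(slot `X` peeled), via `(X, G)` (slot `Y`) or via `(X, Y)` (slot `G`). [this work] -/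
theorem suppZeroFlag_three_iff_zVia (X Y G : Set (Set ι)) :
    SuppZeroFlag 3 ![X, Y, G] ↔ ZVia Y G X ∨ ZVia X G Y ∨ ZVia X Y G := by
  rw [suppZeroFlag_three_iff_exists]
  constructor
  · rintro ⟨i, hi⟩
    fin_cases i
    · exact Or.inl hi
    · exact Or.inr (Or.inl hi)
    · exact Or.inr (Or.inr hi)
  · rintro (h | h | h)
    · exact ⟨0, h⟩
    · exact ⟨1, h⟩
    · exact ⟨2, h⟩

omit [Fintype ι] in
/-- A coordinate affecting `X ∩ G` affects `X` or `G`. [folklore] -/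
theorem affects_inter_imp {X G : Set (Set ι)} {t : ι} (h : Affects (X ∩ G) t) : Affects X t ∨ Affects G t := by
  obtain ⟨ω, hω, htω⟩ := h
  by_cases hX : ω ∈ X
  · exact Or.inr ⟨ω, fun hG => hω ⟨hX, hG⟩, htω.2⟩
  · exact Or.inl ⟨ω, hX, htω.1⟩

omit [Fintype ι] in
/-- If `t` does not affect the increasing event `X`, then `t` affects `X ∩ G` exactly when some configuration of `X`
is `t`-pivotal for `G` (the core of Lemma Z). [this work] -/
theorem affects_inter_iff_of_not_affects {X G : Set (Set ι)} (hX : IsUpperSet X) {t : ι} (ht : ¬ Affects X t) :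
    Affects (X ∩ G) t ↔ ∃ ω ∈ X, ω ∉ G ∧ insert t ω ∈ G := by
  constructor
  · rintro ⟨ω, hω, htω⟩
    have hωX : ω ∈ X := (insert_mem_iff_of_not_affects hX ht ω).1 htω.1
    exact ⟨ω, hωX, fun hG => hω ⟨hωX, hG⟩, htω.2⟩
  · rintro ⟨ω, hωX, hωG, htω⟩
    exact ⟨ω, fun h => hωG h.2, hX (Set.subset_insert t ω) hωX, htω⟩

/-- **Lemma Z (unpacked, increasing events).**  If `(X, Y, G) ∈ Z_3` via the pair `(X, Y)` then the essential supports
of `X` and `Y` are disjoint, no configuration of `X` is `t`-pivotal for `G` for any `t ∈ esupp Y`, and no configuration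
of `Y` is `s`-pivotal for `G` for any `s ∈ esupp X`. [this work] -/
theorem zVia_pivotal {X Y G : Set (Set ι)} (hX : IsUpperSet X) (hY : IsUpperSet Y) (hG : IsUpperSet G)
    (h : ZVia X Y G) :
    Disjoint (esupp X) (esupp Y) ∧
      (∀ t ∈ esupp Y, ∀ ω ∈ X, ω ∉ G → insert t ω ∉ G) ∧
      (∀ s ∈ esupp X, ∀ ω ∈ Y, ω ∉ G → insert s ω ∉ G) := by
  obtain ⟨hXY, hXGY, hXYG⟩ := h
  have dXY := (suppZeroFlag_two_iff hX hY).1 hXY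
  have dXGY := (suppZeroFlag_two_iff (hX.inter hG) hY).1 hXGY
  have dXYG := (suppZeroFlag_two_iff hX (hY.inter hG)).1 hXYG
  refine ⟨dXY, fun t ht ω hωX hωG htG => ?_, fun s hs ω hωY hωG hsG => ?_⟩
  · have htX : ¬ Affects X t := fun h => Finset.disjoint_left.1 dXY (mem_esupp.2 h) ht
    have : t ∈ esupp (X ∩ G) := mem_esupp.2 ((affects_inter_iff_of_not_affects hX htX).2 ⟨ω, hωX, hωG, htG⟩)
    exact Finset.disjoint_left.1 dXGY this ht
  · have hsY : ¬ Affects Y s := fun h => Finset.disjoint_left.1 dXY hs (mem_esupp.2 h)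
    have : s ∈ esupp (Y ∩ G) := mem_esupp.2 ((affects_inter_iff_of_not_affects hY hsY).2 ⟨ω, hωY, hωG, hsG⟩)
    exact Finset.disjoint_left.1 dXYG hs this

/-- The converse of Lemma Z: the three conditions give `Z_3` via `(X, Y)`. [this work] -/
theorem zVia_of_pivotal {X Y G : Set (Set ι)} (hX : IsUpperSet X) (hY : IsUpperSet Y) (hG : IsUpperSet G)
    (dXY : Disjoint (esupp X) (esupp Y))
    (hXp : ∀ t ∈ esupp Y, ∀ ω ∈ X, ω ∉ G → insert t ω ∉ G)
    (hYp : ∀ s ∈ esupp X, ∀ ω ∈ Y, ω ∉ G → insert s ω ∉ G) : ZVia X Y G := by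
  refine ⟨(suppZeroFlag_two_iff hX hY).2 dXY, (suppZeroFlag_two_iff (hX.inter hG) hY).2 ?_,
    (suppZeroFlag_two_iff hX (hY.inter hG)).2 ?_⟩
  · rw [Finset.disjoint_left]
    intro t htXG htY
    have htX : ¬ Affects X t := fun h => Finset.disjoint_left.1 dXY (mem_esupp.2 h) htY
    obtain ⟨ω, hωX, hωG, htG⟩ := (affects_inter_iff_of_not_affects hX htX).1 (mem_esupp.1 htXG)
    exact hXp t htY ω hωX hωG htG
  · rw [Finset.disjoint_left]
    intro s hsX hsYG
    have hsY : ¬ Affects Y s := fun h => Finset.disjoint_left.1 dXY hsX (mem_esupp.2 h)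
    obtain ⟨ω, hωY, hωG, hsG⟩ := (affects_inter_iff_of_not_affects hY hsY).1 (mem_esupp.1 hsYG)
    exact hYp s hsX ω hωY hωG hsG

/-- A triple in `Z_3` via `(X, Y)` cannot have `X` and `Y` sharing an essential coordinate. [this work] -/
theorem not_zVia_of_inter_nonempty {X Y G : Set (Set ι)} (hX : IsUpperSet X) (hY : IsUpperSet Y)
    (h : (esupp X ∩ esupp Y).Nonempty) : ¬ ZVia X Y G := by
  rintro ⟨hXY, -, -⟩
  obtain ⟨i, hi⟩ := h
  exact Finset.disjoint_left.1 ((suppZeroFlag_two_iff hX hY).1 hXY) (mem_inter.1 hi).1 (mem_inter.1 hi).2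

/-! ### Sections and supports -/

omit [Fintype ι] in
/-- A section of an increasing event not depending on `e` is the event itself. [folklore] -/
theorem secAt_eq_self_of_not_affects {A : Set (Set ι)} (hA : IsUpperSet A) {e : ι} (he : ¬ Affects A e) (b : Bool) :
    secAt e b A = A := by
  ext ω
  rw [mem_secAt]
  cases b
  · simp only [forceAt, cond_false]
    by_cases heω : e ∈ ω
    · conv_rhs => rw [← Set.insert_eq_of_mem heω, ← Set.insert_sdiff_singleton]
      exact (insert_mem_iff_of_not_affects hA he _).symm
    · rw [Set.sdiff_singleton_eq_self heω]
  · simp only [forceAt, cond_true]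
    exact insert_mem_iff_of_not_affects hA he ω

omit [Fintype ι] in
/-- Sections do not depend on the sectioned coordinate. [folklore] -/
theorem not_affects_secAt (e : ι) (b : Bool) (A : Set (Set ι)) : ¬ Affects (secAt e b A) e := by
  rintro ⟨ω, hω, heω⟩
  exact hω ((insert_mem_secAt_iff e b A ω).1 heω)

/-- The essential support of a section lies in the essential support minus the sectioned coordinate. [folklore] -/
theorem esupp_secAt_subset {A : Set (Set ι)} (hA : IsUpperSet A) (e : ι) (b : Bool) :
    esupp (secAt e b A) ⊆ (esupp A).erase e := by
  intro f hf
  have hfe : f ≠ e := by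
    rintro rfl
    exact not_affects_secAt f b A (mem_esupp.1 hf)
  rw [mem_erase]
  refine ⟨hfe, ?_⟩
  rw [mem_esupp] at hf ⊢
  obtain ⟨ω, hω, hfω⟩ := hf
  rw [mem_secAt] at hω hfω
  by_contra hfA
  apply hω
  cases b
  · simp only [forceAt, cond_false] at hfω ⊢
    have : insert f ω \ {e} = insert f (ω \ {e}) := by
      ext i; simp only [Set.mem_sdiff, Set.mem_insert_iff, Set.mem_singleton_iff]
      constructor
      · rintro ⟨rfl | hi, hie⟩
        · exact Or.inl rfl
        · exact Or.inr ⟨hi, hie⟩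
      · rintro (rfl | ⟨hi, hie⟩)
        · exact ⟨Or.inl rfl, hfe⟩
        · exact ⟨Or.inr hi, hie⟩
    rw [this] at hfω
    exact (insert_mem_iff_of_not_affects hA hfA _).1 hfω
  · simp only [forceAt, cond_true] at hfω ⊢
    rw [Set.insert_comm] at hfω
    exact (insert_mem_iff_of_not_affects hA hfA _).1 hfω

/-- A coordinate `f ≠ e` affecting `A` affects one of the two `e`-sections. [folklore] -/
theorem mem_esupp_secAt_or {A : Set (Set ι)} {e f : ι} (hf : f ∈ esupp A) (hfe : f ≠ e) :
    f ∈ esupp (secAt e false A) ∨ f ∈ esupp (secAt e true A) := by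
  rw [mem_esupp] at hf
  obtain ⟨ω, hω, hfω⟩ := hf
  by_cases heω : e ∈ ω
  · right
    rw [mem_esupp]
    refine ⟨ω, ?_, ?_⟩
    · rw [mem_secAt]; simp only [forceAt, cond_true]; rwa [Set.insert_eq_of_mem heω]
    · rw [mem_secAt]; simp only [forceAt, cond_true]
      rwa [Set.insert_eq_of_mem (Set.mem_insert_of_mem f heω)]
  · left
    rw [mem_esupp]
    refine ⟨ω, ?_, ?_⟩
    · rw [mem_secAt]; simp only [forceAt, cond_false]; rwa [Set.sdiff_singleton_eq_self heω]
    · rw [mem_secAt]; simp only [forceAt, cond_false]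
      have : e ∉ insert f ω := by
        rintro (h | h)
        · exact hfe h.symm
        · exact heω h
      rwa [Set.sdiff_singleton_eq_self this]

end Summit.CriticalPhenomena.PercolationContinuityZ3.Theorems
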